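import Summits.Ventures.PercRepro.S2CoreEighteenSeven
import Summits.Ventures.PercRepro.S2CapFree
import Summits.Ventures.PercRepro.S2SeriesCapSeven
import Summits.Ventures.PercRepro.RankLevelSetFourCircuitNullityFour
import Summits.Ventures.PercRepro.S2SharpCoreXMidCTQ
import Summits.Ventures.PercRepro.S2MidFlatsSeven
import Summits.Ventures.PercRepro.S2MidFlatsTenD
import Summits.Ventures.PercRepro.S2CellsP17A

/-!
# PercRepro — THE CELLS `(17, 7)`, `(17, 8)`, `(17, 9)` OF THE `p = 17` ROW BY THE COLOOP SPLIT (p7, gen 8; sub-claim S2; the «18» kit)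

The three cells of the `p = 17` row that do not close on the standard caps (`1.116 / 1.066 / 1.007` with p8's `avgChain16`),
each split on the coloops of the core (S2CoreEighteenSeven's device; the weighted step `weighted_of_isColoop_scaled` below is
`rls_of_isColoop_scaled` with a free weight, so it can be iterated):
* `(17, 7)`: no coloop — `s₄ ≤ 46` (S2SeriesCapSeven: the series-class averaging on `24` points, from p8's `avgChain16 5 = 28`)
  and `s₅ ≤ ⌊24·234/19⌋ = 295` (S2CapFree) on the quart core, `0.994` (`cellP17F7`); a coloop `e` — the scaled cell `(16, 7)`
  of `M ∖ e` at `K = C(22, 5) = 26334` with `avgChain16 7 = 69`, `avgChain5b 7 = 401`, `0.985` (`cellP16S7`);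
* `(17, 8)`: no coloop — `s₄ ≤ ⌊25·69/21⌋ = 82`, `s₅ ≤ ⌊25·401/20⌋ = 501`, `N_mid = 7·C(12, 6)` on the quart XMid core,
  `0.983` (`cellP17F8`); a coloop `e` with `M ∖ e` coloop-free — the scaled cell `(16, 8)` with `⌊24·69/20⌋ = 82`,
  `⌊24·401/19⌋ = 506`, `0.957` (`cellP16S8`); a second coloop `f` of `M ∖ e` — the twice-scaled cell `(15, 8)` of `M ∖ e ∖ f`
  at `Φ(17, 5)/4 ≤ 2^20/26334` with `avgChain16 8 = 99`, `avgChain5b 8 = 651`, `0.975` (`cellP15S8`);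
* `(17, 9)`: no coloop — `s₄ ≤ ⌊26·99/22⌋ = 117`, `s₅ ≤ ⌊26·651/21⌋ = 806`, `0.925` (`cellP17F9`); a coloop — the scaled cell
  `(16, 9)` with `avgChain16 9 = 138`, `avgChain5b 9 = 1012`, `0.946` (`cellP16S9`).
Declarations: `weighted_of_isColoop_scaled`, `delete_core_data` (the bookkeeping of one deletion), **`c025_core_five_seventeen_seven`**,
**`c025_core_five_seventeen_eight`**, **`c025_core_five_seventeen_nine`**. Axioms: standard.
-/

open scoped Matroid

namespace PercRepro

namespace ThmN

open Set

variable {α : Type}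

/-- **The coloop step with a free weight**: `e` a coloop, `r(M) = p + 1`, `q + 1 < p`; if `M ＼ {e}` satisfies
`(Φ/2)·#U(p, q+1) ≤ #Y(p, q+1)` then `M` satisfies `Φ·#U(p+1, q+1) ≤ #Y(p+1, q+1)` (night-1's identities
`#U_M(p+1, q+1) = #U_{M∖e}(p, q+1)`, `#Y_M(p+1, q+1) = 2·#Y_{M∖e}(p, q+1) + W_p + W_{q+1}`). -/
theorem weighted_of_isColoop_scaled (M : Matroid α) [M.Finite] {e : α} (he : M.IsColoop e) {p q : ℕ}
    (hp : q + 1 < p) (hR : M.eRank = ((p + 1 : ℕ) : ℕ∞)) (Φ : ℚ)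
    (h : Φ / 2 * (Matroid.topCount (M ＼ {e}) p (q + 1) : ℚ) ≤ (Matroid.midCount (M ＼ {e}) p (q + 1) : ℚ)) :
    Φ * (Matroid.topCount M (p + 1) (q + 1) : ℚ) ≤ (Matroid.midCount M (p + 1) (q + 1) : ℚ) := by
  rw [Matroid.topCount_eq_of_isColoop_of_eRank he q hR, Matroid.midCount_eq_of_isColoop_q he hp]
  push_cast
  have h0 : (0 : ℚ) ≤ (Matroid.levelCount (M ＼ {e}) p : ℚ) := by positivity
  have h0' : (0 : ℚ) ≤ (Matroid.levelCount (M ＼ {e}) (q + 1) : ℚ) := by positivity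
  linarith [h, h0, h0']

/-- **The bookkeeping of one coloop deletion**: `r(M) = p + 1`, `|E| = p + 1 + d`, `e` a coloop ⇒ `M ＼ {e}` is an `e`-free
core with `r = p`, `|E| = p + d` and nullity `d`. -/
theorem delete_core_data (M : Matroid α) [M.Finite] {e : α} (he : M.IsColoop e) {p d : ℕ}
    (hR : M.eRank = ((p + 1 : ℕ) : ℕ∞)) (hn : M.E.ncard = p + 1 + d)
    (hfree : ∀ e ∈ M.E, ∃ A ⊆ M.E \ {e}, e ∉ M.closure A ∧ e ∉ M.closure ((M.E \ {e}) \ A)) :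
    (M ＼ {e}).E.ncard = p + d ∧ (M ＼ {e}).eRank = ((p : ℕ) : ℕ∞) ∧
      (∀ x ∈ (M ＼ {e}).E, ∃ A ⊆ (M ＼ {e}).E \ {x},
        x ∉ (M ＼ {e}).closure A ∧ x ∉ (M ＼ {e}).closure (((M ＼ {e}).E \ {x}) \ A)) ∧
      (M ＼ {e}).E.encard = (M ＼ {e}).eRank + ((d : ℕ) : ℕ∞) := by
  have heE : e ∈ M.E := he.mem_ground
  have hn' : (M ＼ {e}).E.ncard = p + d := by
    have h1 := Set.ncard_sdiff_singleton_add_one heE M.ground_finite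
    rw [Matroid.delete_ground]
    omega
  have hR' : (M ＼ {e}).eRank = ((p : ℕ) : ℕ∞) := by
    have h1 : M.eRk ((M.E \ {e}) ∪ {e}) = M.eRk (M.E \ {e}) + ({e} : Set α).encard :=
      eRk_union_eq_of_subset_coloops Set.sdiff_subset (Set.singleton_subset_iff.2 he) Set.disjoint_sdiff_left
    rw [Set.sdiff_union_of_subset (Set.singleton_subset_iff.2 heE), ← Matroid.eRank_def, hR,
      Set.encard_singleton] at h1
    rw [Matroid.delete_eq_restrict, Matroid.eRank_restrict]
    have h2 : M.eRk (M.E \ {e}) + 1 = ((p : ℕ) : ℕ∞) + 1 := by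
      rw [← h1]; push_cast; ring
    exact WithTop.add_right_cancel (by norm_num : (1 : ℕ∞) ≠ ⊤) h2
  have hfree' := hfree_delete_singleton M hfree e
  have hd' : (M ＼ {e}).E.encard = (M ＼ {e}).eRank + ((d : ℕ) : ℕ∞) := by
    rw [hR', ← (M ＼ {e}).ground_finite.cast_ncard_eq, hn']
    push_cast
    ring
  exact ⟨hn', hR', hfree', hd'⟩

/-- `Φ(17, 5)/2 ≤ 2^21/26334` and `Φ(17, 5)/4 ≤ 2^20/26334`. -/
theorem phiK_seventeen_five_scaled :
    phiK 17 5 / 2 ≤ (2 : ℚ) ^ (16 + 5) / ((26334 : ℕ) : ℚ) ∧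
      phiK 17 5 / 4 ≤ (2 : ℚ) ^ (15 + 5) / ((26334 : ℕ) : ℚ) := by
  have h := phiK_le_two_pow_div 17 5
  rw [Nat.choose_symm_add] at h
  have hc : ((17 + 5).choose 5 : ℚ) = 26334 := by norm_num [Nat.choose]
  rw [hc] at h
  have e1 : (2 : ℚ) ^ (17 + 5) = 2 * 2 ^ (16 + 5) := by norm_num
  have e2 : (2 : ℚ) ^ (17 + 5) = 4 * 2 ^ (15 + 5) := by norm_num
  constructor
  · rw [e1] at h
    push_cast
    linarith
  · rw [e2] at h
    push_cast
    linarith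

/-- **The `e`-free core at level `5`, rank `17`, corank `7`** — no coloop: the series-class cap `s₄ ≤ 46` and
`s₅ ≤ 295`; a coloop: the scaled cell `(16, 7)`. -/
theorem c025_core_five_seventeen_seven (M : Matroid α) [M.Finite]
    (hR : M.eRank = ((17 : ℕ) : ℕ∞)) (hn : M.E.ncard = 17 + 7)
    (hfree : ∀ e ∈ M.E, ∃ A ⊆ M.E \ {e}, e ∉ M.closure A ∧ e ∉ M.closure ((M.E \ {e}) \ A)) :
    RLS M 17 5 := by
  classical
  have hd : M.E.encard = M.eRank + ((7 : ℕ) : ℕ∞) := by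
    rw [hR, ← M.ground_finite.cast_ncard_eq, hn]
    push_cast
    ring
  have hs3 := TriangleCap.core_ncard_triangles_le_cq3 M hfree hd
  rw [show TriangleCap.cq3 7 = 11 by decide] at hs3
  by_cases hK : ∃ e, M.IsColoop e
  · -- a coloop: the scaled cell `(16, 7)`
    obtain ⟨e, he⟩ := hK
    obtain ⟨hn', hR', hfree', hd'⟩ := delete_core_data M he (p := 16) (d := 7) (by rw [hR]) hn hfree
    have hs3' := TriangleCap.core_ncard_triangles_le_cq3 (M ＼ {e}) hfree' hd'
    rw [show TriangleCap.cq3 7 = 11 by decide] at hs3'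
    have hs4' := ncard_fourCircuits_le_avgChain16 7 (M ＼ {e}) hfree' hd'
    rw [avgChain16_values.1] at hs4'
    have hs5' := S1.ncard_fiveCircuits_le_avgChain5b 7 (M ＼ {e}) hfree' hd'
    rw [S1.avgChain5b_values.1] at hs5'
    have key := c025_core_five_sharp_cell_xqictq5g (M ＼ {e}) 16 7 (by norm_num) (by norm_num) hR' hn' hfree'
      11 69 401 hs3' hs4' hs5' 26334 (by norm_num) (phiK 17 5 / 2) phiK_seventeen_five_scaled.1
      ⟨68, by norm_num, S2.cellP16S7_poly, S2.cellP16S7_tail⟩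
    rw [RLS_iff]
    exact weighted_of_isColoop_scaled M he (by norm_num : 4 + 1 < 16) (by rw [hR]) (phiK 17 5) key
  · -- no coloop: `s₄ ≤ 46`, `s₅ ≤ 295`
    push Not at hK
    have hcol : M.coloops = ∅ := S2.coloops_eq_empty_of_forall_not M hK
    have hs4 := S2.ncard_fourCircuits_le_fortySix_of_seven_free M hfree (by exact_mod_cast hd) hn hcol
      (fun M' _ hfree' hd5 => by
        have h := ncard_fourCircuits_le_avgChain16 5 M' hfree' hd5
        exact h)
    have hd6 : M.E.encard = M.eRank + (((6 : ℕ) : ℕ∞) + 1) := by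
      rw [hd]; norm_num
    have hs5 := S2.ncard_fiveCircuits_le_of_no_coloop M hfree hd6 hK (by omega)
    rw [hn] at hs5
    have h295 : (17 + 7) * S1.avgChain5b 6 / (17 + 7 - 5) = 295 := by decide
    rw [h295] at hs5
    exact c025_core_five_sharp_cell_xqictq5 M 17 7 (by norm_num) (by norm_num) hR hn hfree 11 46 295 hs3 hs4 hs5
      ⟨44, by norm_num, S2.cellP17F7_poly, S2.cellP17F7_tail⟩

/-- **The `e`-free core at level `5`, rank `17`, corank `9`** — no coloop: `s₄ ≤ 117`, `s₅ ≤ 806`; a coloop: the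
scaled cell `(16, 9)`. -/
theorem c025_core_five_seventeen_nine (M : Matroid α) [M.Finite]
    (hR : M.eRank = ((17 : ℕ) : ℕ∞)) (hn : M.E.ncard = 17 + 9)
    (hfree : ∀ e ∈ M.E, ∃ A ⊆ M.E \ {e}, e ∉ M.closure A ∧ e ∉ M.closure ((M.E \ {e}) \ A)) :
    RLS M 17 5 := by
  classical
  have hd : M.E.encard = M.eRank + ((9 : ℕ) : ℕ∞) := by
    rw [hR, ← M.ground_finite.cast_ncard_eq, hn]
    push_cast
    ring
  have hs3 := TriangleCap.core_ncard_triangles_le_cq3 M hfree hd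
  rw [show TriangleCap.cq3 9 = 16 by decide] at hs3
  by_cases hK : ∃ e, M.IsColoop e
  · -- a coloop: the scaled cell `(16, 9)`
    obtain ⟨e, he⟩ := hK
    obtain ⟨hn', hR', hfree', hd'⟩ := delete_core_data M he (p := 16) (d := 9) (by rw [hR]) hn hfree
    have hs3' := TriangleCap.core_ncard_triangles_le_cq3 (M ＼ {e}) hfree' hd'
    rw [show TriangleCap.cq3 9 = 16 by decide] at hs3'
    have hs4' := ncard_fourCircuits_le_avgChain16 9 (M ＼ {e}) hfree' hd'
    rw [avgChain16_values.2.2.1] at hs4'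
    have hs5' := S1.ncard_fiveCircuits_le_avgChain5b 9 (M ＼ {e}) hfree' hd'
    rw [S1.avgChain5b_values.2.2.1] at hs5'
    have key := c025_core_five_sharp_cell_xqictq5g (M ＼ {e}) 16 9 (by norm_num) (by norm_num) hR' hn' hfree'
      16 138 1012 hs3' hs4' hs5' 26334 (by norm_num) (phiK 17 5 / 2) phiK_seventeen_five_scaled.1
      ⟨131, by norm_num, S2.cellP16S9_poly, S2.cellP16S9_tail⟩
    rw [RLS_iff]
    exact weighted_of_isColoop_scaled M he (by norm_num : 4 + 1 < 16) (by rw [hR]) (phiK 17 5) key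
  · -- no coloop: `m = 26` non-coloops
    push Not at hK
    have hcol : M.coloops = ∅ := S2.coloops_eq_empty_of_forall_not M hK
    have hm : 26 ≤ (M.E \ M.coloops).ncard := by
      rw [hcol, Set.sdiff_empty, hn]
    have hd8 : M.E.encard = M.eRank + (((8 : ℕ) : ℕ∞) + 1) := by
      rw [hd]; norm_num
    have h := S1.ncard_fourCircuits_sub_div_le_of_nonColoops M hfree hd8 (by norm_num) hm (B := 99)
      (fun M' _ hfree' hd8' => by
        have h := ncard_fourCircuits_le_avgChain16 8 M' hfree' hd8'
        rw [avgChain16_values.2.1] at h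
        exact h)
    have hs4 : {C : Set α | M.IsCircuit C ∧ C.ncard = 4}.ncard ≤ 117 := by
      have := S1.le_mul_div_of_sub_div_le (by norm_num : 4 < 26) h
      omega
    have hs5 := S2.ncard_fiveCircuits_le_of_no_coloop M hfree hd8 hK (by omega)
    rw [hn] at hs5
    have h806 : (17 + 9) * S1.avgChain5b 8 / (17 + 9 - 5) = 806 := by
      rw [S1.avgChain5b_values.2.1]
    rw [h806] at hs5
    exact c025_core_five_sharp_cell_xqictq5 M 17 9 (by norm_num) (by norm_num) hR hn hfree 16 117 806 hs3 hs4 hs5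
      ⟨94, by norm_num, S2.cellP17F9_poly, S2.cellP17F9_tail⟩

/-- **The `e`-free core at level `5`, rank `17`, corank `8`** — no coloop: `s₄ ≤ 82`, `s₅ ≤ 501`, `N_mid = 7·C(12, 6)`; a
coloop `e` with `M ∖ e` coloop-free: the scaled cell `(16, 8)` with `82 / 506`; a second coloop: the twice-scaled cell
`(15, 8)`. -/
theorem c025_core_five_seventeen_eight (M : Matroid α) [M.Finite]
    (hR : M.eRank = ((17 : ℕ) : ℕ∞)) (hn : M.E.ncard = 17 + 8)
    (hfree : ∀ e ∈ M.E, ∃ A ⊆ M.E \ {e}, e ∉ M.closure A ∧ e ∉ M.closure ((M.E \ {e}) \ A)) :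
    RLS M 17 5 := by
  classical
  have hd : M.E.encard = M.eRank + ((8 : ℕ) : ℕ∞) := by
    rw [hR, ← M.ground_finite.cast_ncard_eq, hn]
    push_cast
    ring
  have hs3 := TriangleCap.core_ncard_triangles_le_cq3 M hfree hd
  rw [show TriangleCap.cq3 8 = 13 by decide] at hs3
  by_cases hK : ∃ e, M.IsColoop e
  · -- a coloop `e`
    obtain ⟨e, he⟩ := hK
    obtain ⟨hn', hR', hfree', hd'⟩ := delete_core_data M he (p := 16) (d := 8) (by rw [hR]) hn hfree
    set N := M ＼ {e} with hN
    have hs3' := TriangleCap.core_ncard_triangles_le_cq3 N hfree' hd'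
    rw [show TriangleCap.cq3 8 = 13 by decide] at hs3'
    have key : phiK 17 5 / 2 * (Matroid.topCount N 16 5 : ℚ) ≤ (Matroid.midCount N 16 5 : ℚ) := by
      by_cases hK' : ∃ f, N.IsColoop f
      · -- a second coloop `f`: the twice-scaled cell `(15, 8)`
        obtain ⟨f, hf⟩ := hK'
        obtain ⟨hn'', hR'', hfree'', hd''⟩ := delete_core_data N hf (p := 15) (d := 8) (by rw [hR']) hn' hfree'
        have hs3'' := TriangleCap.core_ncard_triangles_le_cq3 (N ＼ {f}) hfree'' hd''
        rw [show TriangleCap.cq3 8 = 13 by decide] at hs3''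
        have hs4'' := ncard_fourCircuits_le_avgChain16 8 (N ＼ {f}) hfree'' hd''
        rw [avgChain16_values.2.1] at hs4''
        have hs5'' := S1.ncard_fiveCircuits_le_avgChain5b 8 (N ＼ {f}) hfree'' hd''
        rw [S1.avgChain5b_values.2.1] at hs5''
        have key' := c025_core_five_sharp_cell_xqictq5g (N ＼ {f}) 15 8 (by norm_num) (by norm_num) hR'' hn'' hfree''
          13 99 651 hs3'' hs4'' hs5'' 26334 (by norm_num) (phiK 17 5 / 4) phiK_seventeen_five_scaled.2
          ⟨139, by norm_num, S2.cellP15S8_poly, S2.cellP15S8_tail⟩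
        have key'' : phiK 17 5 / 2 / 2 * (Matroid.topCount (N ＼ {f}) 15 (4 + 1) : ℚ) ≤
            (Matroid.midCount (N ＼ {f}) 15 (4 + 1) : ℚ) := by
          rw [div_div, show (2 : ℚ) * 2 = 4 by norm_num]
          exact key'
        exact weighted_of_isColoop_scaled N hf (by norm_num : 4 + 1 < 15) (by rw [hR']) (phiK 17 5 / 2) key''
      · -- `N` coloop-free: the scaled cell `(16, 8)` with the coloop-free caps `82 / 506`
        push Not at hK'
        have hcol' : N.coloops = ∅ := S2.coloops_eq_empty_of_forall_not N hK'
        have hm' : 24 ≤ (N.E \ N.coloops).ncard := by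
          rw [hcol', Set.sdiff_empty, hn']
        have hd7' : N.E.encard = N.eRank + (((7 : ℕ) : ℕ∞) + 1) := by
          rw [hd']; norm_num
        have h := S1.ncard_fourCircuits_sub_div_le_of_nonColoops N hfree' hd7' (by norm_num) hm' (B := 69)
          (fun M' _ hfree'' hd7'' => by
            have h := ncard_fourCircuits_le_avgChain16 7 M' hfree'' hd7''
            rw [avgChain16_values.1] at h
            exact h)
        have hs4' : {C : Set α | N.IsCircuit C ∧ C.ncard = 4}.ncard ≤ 82 := by
          have := S1.le_mul_div_of_sub_div_le (by norm_num : 4 < 24) h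
          omega
        have hs5' := S2.ncard_fiveCircuits_le_of_no_coloop N hfree' hd7' hK' (by omega)
        rw [hn'] at hs5'
        have h506 : (16 + 8) * S1.avgChain5b 7 / (16 + 8 - 5) = 506 := by
          rw [S1.avgChain5b_values.1]
        rw [h506] at hs5'
        exact c025_core_five_sharp_cell_xqictq5g N 16 8 (by norm_num) (by norm_num) hR' hn' hfree'
          13 82 506 hs3' hs4' hs5' 26334 (by norm_num) (phiK 17 5 / 2) phiK_seventeen_five_scaled.1
          ⟨94, by norm_num, S2.cellP16S8_poly, S2.cellP16S8_tail⟩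
    rw [RLS_iff]
    exact weighted_of_isColoop_scaled M he (by norm_num : 4 + 1 < 16) (by rw [hR]) (phiK 17 5) key
  · -- no coloop: the quart XMid core with `N_mid = 7·C(12, 6)`, `s₄ ≤ 82`, `s₅ ≤ 501`
    push Not at hK
    have hcol : M.coloops = ∅ := S2.coloops_eq_empty_of_forall_not M hK
    have hL0 : ∀ e ∈ M.E, ¬ M.IsLoop e := not_isLoop_of_free M hfree
    have hflat' : ∀ X ⊆ M.E, M.eRk X ≤ ((5 - 1 : ℕ) : ℕ∞) → X.ncard ≤ 10 := fun X hX hr =>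
      ncard_le_ten_of_eRk_le_four_of_free M hfree hX (by simpa using hr)
    have hC2 : ∀ P ⊆ M.E, M.eRk P ≤ 3 → P.ncard ≤ 6 :=
      fun P hP hr => ncard_le_six_of_eRk_le_three_of_free M hfree hP hr
    have hC0 : ∀ X ⊆ M.E, M.eRk X ≤ 1 → X.ncard ≤ 1 := fun X hX hr => by
      have := ncard_add_one_le_two_pow_of_eRk_le M hL0 hfree 1 X hX hr
      omega
    have hmid := S2.card_spanMid_le_seven hflat' hC2 hC0 hd
    have hmid' : (S2.spanMid M 5 (min 10 (4 + 8)) ((8 + 6) / 2 + 1)).card ≤ 7 * (12).choose 6 := by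
      rw [show min 10 (4 + 8) = 10 by norm_num, show (8 + 6) / 2 + 1 = 8 by norm_num]
      exact hmid
    have hm : 25 ≤ (M.E \ M.coloops).ncard := by
      rw [hcol, Set.sdiff_empty, hn]
    have hd7 : M.E.encard = M.eRank + (((7 : ℕ) : ℕ∞) + 1) := by
      rw [hd]; norm_num
    have h := S1.ncard_fourCircuits_sub_div_le_of_nonColoops M hfree hd7 (by norm_num) hm (B := 69)
      (fun M' _ hfree' hd7' => by
        have h := ncard_fourCircuits_le_avgChain16 7 M' hfree' hd7'
        rw [avgChain16_values.1] at h
        exact h)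
    have hs4 : {C : Set α | M.IsCircuit C ∧ C.ncard = 4}.ncard ≤ 82 := by
      have := S1.le_mul_div_of_sub_div_le (by norm_num : 4 < 25) h
      omega
    have hs5 := S2.ncard_fiveCircuits_le_of_no_coloop M hfree hd7 hK (by omega)
    rw [hn] at hs5
    have h501 : (17 + 8) * S1.avgChain5b 7 / (17 + 8 - 5) = 501 := by
      rw [S1.avgChain5b_values.1]
    rw [h501] at hs5
    have key := c025_core_five_sharp_cell_xmidctq M 17 8 (7 * (12).choose 6) (by norm_num) hR hn hfree 13 82 501
      hs3 hs4 hs5 hmid'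
    exact key ⟨87, by norm_num, S2.cellP17F8_poly, S2.cellP17F8_tail⟩

end ThmN

end PercRepro
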